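import Summits.QuantumFields.BalabanUV.Beta.D1BFx.PackedColumnBlockTotalMass

/-!
# `BalabanUV.Beta.D1BFx.PackedStraightColumn` — road «BF-x» for binder row D1, slot (K), PART 24 letter «M-pack» AT THE CHART OF RECORD (α′), FILE A of «K0-PACK»:
# **THE (M-b) PACKED-VERTEX ROW AT ANY PACKED KERNEL WITH A DISPLAYED COLUMN ENVELOPE (FILE 2 §2 MADE PIN-AGNOSTIC), AND THE STRAIGHT ONE-SHOT COLUMN
# `colH (KInvStep 3 n 0) n`: ITS `n⁻⁵` ENVELOPE IN THE ROAD's `ℓ¹` FORM AND ITS WEIGHTED `ℓ¹` LAW `≤ n⁻¹·(…)` («K0-COL-L1»)** — UNCONDITIONAL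

HONEST DEPENDENCY (cell records, verbatim): «continuum YM on T⁴ ⇐ BetaPertH ∧ nine spine estimates (0/9 proved); BetaPertH ⇐ (D1) ∧ (D4) ∧
CAP+tail; G-an2-4 gates asym, D1 and NE2/3/4.»  HONEST FRAMING (cell contract, verbatim): «discharging `BetaPertH` makes Bałaban's UV stability
UNCONDITIONAL — a real constructive-QFT result; it is NOT the continuum limit and NOT the Clay problem.»  THIS MODULE DISCHARGES NOTHING of the
wall: [folklore] `ℓ¹` bookkeeping BY NAME over LANDED objects (this lineage's FILE 2 `PackedColumnBlockTotalMass` §1 `tsum_abs_mul_le_of_blockTotal`, g53's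
`PackedColumnEnvelope.abs_colH_KInvStep_zero_le` over d1-formalise-leaf-05's UNCONDITIONAL `FP.CompositeMinimiserDecay.abs_wH_le`, d1-leaf-04's
`RestJetBlockMass.stencil_mass_recentre ∕ mass_sum_wsum_le`, gan24-leaf-12's `EnvelopeBlockSum.env_le_exp_l1`).  No definition, no `def … : Prop`, nothing cited,
0 sorry.  Every table letter is a DISPLAYED hypothesis on an ARBITRARY family; NO (1.22) row is proved; 0 root-level binders of row D1 discharged (hW ∕ hR-sockets ∕
hSX-socket ∕ D1Tel ∕ D1Rep = 0); (J1) ONE OPEN ROW; (K) NOT closed; NOT D1, NEVER «G-an2-4 closed», NOT `BetaPertH`, NOT continuum, NOT Clay.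

ABSOLUTE RULE (cell charter, verbatim): «No internally-minted statement may enter as a cited fact. Every hypothesis is either kernel-proved in
this package or a verbatim quotation of a PUBLISHED theorem with page reference. The manuscript(s) under audit are NOT citable for their own
disputed steps — they are the thing under adjudication; programme-internal (2001/route/tribunal) claims are never citable.»

WHY.  The chart of record for slot (K)'s tt rests is (α′) (row OWNER an2 R-D1-g44-2; road OWNER d1-p2 g23 `COLUMN-GAUGE-INSTANCE-SPEC-g23.md`): the bm-dressed
packed vertex splits `V^{bm} = V^{smooth} + G`, `V^{smooth} μ y := Σ_{κ,u} colH (KInvStep n 0) n μ y κ u • S⁰ κ u` (d1-leaf-01 `DressedVertexSplit`), the gauge words are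
CANCELLED EXACTLY (`ColumnGaugeInvariance.hessKer_columnGauge_of_relInv`) and ONLY the smooth-column words are priced (PART24-SPEC-g23 §1: (T), (BB), (AB), (BA));
PART24-SPEC §2 lists «M-pack (exists modulo units): packed vertex ∕ pair-vertex block masses WITH the unit displayed».  This lineage's packed rows of record
(FILE 2 ∕ 4 ∕ 6, g57) are hard-wired to the bm-DRESSED weights `colH (G₀^{bm} r) n` (envelope `n⁻⁴`, «G0-COL-ENV» — honest on the face sheets, d1-leaf-01
`DressedColumnRibbon`, which (α′) no longer prices).  This file makes the single-vertex row PIN-AGNOSTIC (§1: any `K`, its column envelope a displayed letter —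
the twin of FILE 4 §3's K-generic pair row) and supplies the STRAIGHT column's letter (§2): `|colH (KInvStep 3 n 0) n μ y κ u| ≤ (n⁵)⁻¹·C₄·e^{κ′}·e^{−(κ′∕(4n))|u − n•y|₁}`,
KERNEL-EXACT and decider-independent, ONE power below the dressed column; FILE B `PackedStraightColumnMass` reads the rows at that column with the powers displayed.

CONTENT (`d = 3`; `C₄ := MG163 4·periodConst (kappa163 4) 3`, `κ′ := kappa163 4 ∕ 4`).
* §1 [folklore, ANY packed kernel `K : MKer 4 (Fib 3)`, block side `n`, column envelope `|colH K n μ y κ u| ≤ C_H·e^{−ρ|u − n•y|₁}` DISPLAYED]: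
  **`tsum_abs_colH_mul_le_of_blockTotal`** (`Σ'_u |colH K n μ y κ u|·(M u·e^{2σ|u − n•y|₁}) ≤ C_H·e^{2ρn}·Zl 4 (ρn∕2)·T` for `σ ≤ ρ∕4`, `M ≥ 0` with block totals `≤ T`),
  **`mass_sum_wsum_colH_le_of_blockTotal`** (any fibre), **`mass_blk_vertexOfK_le_of_blockTotal`** (every block of `vertexOfK K n S μ y` has `u`-centred `σ`-weighted
  mass at `n•y` `≤ 4·(C_H·e^{2ρn}·Zl 4 (ρn∕2))·T j k` from block-total letters `≤ T j k`, `0 ≤ σ ≤ ρ∕4`).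
* §2 [folklore] the STRAIGHT column (any block side `n ≥ 1`, `[NeZero n]`): **`abs_colH_K₀_road_le`** (`≤ (n⁵)⁻¹·(C₄·e^{κ′})·e^{−(κ′∕(4n))|u − n•y|₁}`; the same VALUE as
  `GhostWardWord.abs_colH_K₀_road_le_l1` ∕ `BlockGaugeEnvelope.abs_colH_K₀_env`, re-derived in twelve lines from `abs_colH_KInvStep_zero_le` so that the mass files'
  import closure stays at FILE 4), `colH_K₀_road_weight_nonneg`, «K0-COL-L1» **`tsum_abs_colH_K₀_mul_exp_le`**: for `σ ≤ κ′∕(16n)`,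
  `Σ'_u |colH K₀ n μ y κ u|·e^{2σ|u − n•y|₁} ≤ n⁻¹·(C₄·e^{κ′}·e^{κ′∕2}·Zl 4 (κ′∕8))` — the column's weighted `ℓ¹` is ONE power below its `n⁴` slots (× `cE = n⁴`: the unit
  page's `Σ|h| ≍ n³` as a BOUND; the factor d1-leaf-01's `ChargeFreeEnvelopes` §4 displays as `Σ'|h|·e^{σ|u − p|}`).
NOT HERE (honest): the rows at `K₀` with the powers displayed (FILE B); any count of any table; any (1.22) row; the gauge words (cancelled, not priced).
Unit `b2b-balaban-gan24-formalise-leaf-05` (gen 60), G-an2-4 swarm leaf prover 05, road «BF-x» supplier (`colH`-weights ∕ mass-letters ∕ packed-currency lineage);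
INTENT-1 «K0-PACK» FILE A (journal [GAN24LEAF05-G60-INTENT-1] ∕ A-1).
-/

noncomputable section

open Finset
open scoped BigOperators
open Literature.MathematicalPhysics.QuantumFieldTheory
open Literature.MathematicalPhysics.QuantumFieldTheory.LatticeForm (quo)
open Literature.MathematicalPhysics.QuantumFieldTheory.Balaban1983to89
open Literature.MathematicalPhysics.QuantumFieldTheory.Balaban1983to89.Beta
open B12Sec2to5 (l1 l1_nonneg)
open B4ContourShift (supNorm)
open B5Hk163Strip (kappa163 kappa163_pos)
open B5Hk163Decay (MG163)
open B4TorusKernel (periodConst)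
open ExpKernelCalculus (Site MKer Zl Zl_pos Zl_nonneg)
open AffineAveraging (box toSite)
open OneStepResolventKernel (Fib wsum)
open OneStepKernelFamily (colH KInvStep vertexOfK)
open Summit.QuantumFields.BalabanUV.Beta.D1BFx.PackedKernelSplit (blk)
open Summit.QuantumFields.BalabanUV.Beta.D1BFx.RestJetBlockMass (stencil_mass_recentre mass_sum_wsum_le)
open Summit.QuantumFields.BalabanUV.Beta.D1BFx.PackedColumnEnvelope (abs_colH_KInvStep_zero_le)
open Summit.QuantumFields.BalabanUV.Beta.GAN24.EnvelopeBlockSum (env_le_exp_l1)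
open Summit.QuantumFields.BalabanUV.Beta.D1BFx.PackedColumnJetMass (blk_vertexOfK)
open Summit.QuantumFields.BalabanUV.Beta.D1BFx.PackedColumnBlockTotalMass (tsum_abs_mul_le_of_blockTotal)

namespace Summit.QuantumFields.BalabanUV.Beta.D1BFx.PackedStraightColumn

/-! ## §1 Generic: ANY packed kernel with an `ℓ¹`-exponential column envelope, against block totals (FILE 2 §2 made pin-agnostic) -/

section Generic

variable (K : MKer 4 (Fib 3)) (n : ℕ) [NeZero n]

/-- [folklore] **ONE PACKED WEIGHT WITH A DISPLAYED COLUMN ENVELOPE AGAINST A SLOT FUNCTION WITH BOUNDED BLOCK TOTALS** (ANY packed kernel `K`): if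
`|colH K n μ y κ u| ≤ C_H·e^{−ρ|u − n•y|₁}` (`0 < ρ`, `0 ≤ C_H`), `σ ≤ ρ∕4` (any sign) and `M ≥ 0` has block totals `Σ_{b ∈ box 4 n} M (n•y′ + b) ≤ T` (every coarse
block `y′`), then `Σ'_u |colH K n μ y κ u|·(M u·e^{2σ|u − n•y|₁}) ≤ C_H·e^{2ρn}·Zl 4 (ρn∕2)·T`, summable — FILE 2 §1 `tsum_abs_mul_le_of_blockTotal` at the rate `ρ∕2`
(`2σ ≤ ρ∕2` absorbed; `(ρ∕2)·4·n = 2ρn`, `(ρ∕2)·n = ρn∕2`). -/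
theorem tsum_abs_colH_mul_le_of_blockTotal {CH ρ σ : ℝ} (hρ : 0 < ρ) (hCH : 0 ≤ CH) (hσ : σ ≤ ρ / 4)
    (μ : Fin (3 + 1)) (y : Fin (3 + 1) → ℤ) (κ : Fin (3 + 1))
    (hcol : ∀ u, |colH K n μ y κ u| ≤ CH * Real.exp (-ρ * l1 (u - (n : ℤ) • y)))
    {M : (Fin (3 + 1) → ℤ) → ℝ} {T : ℝ} (hM0 : ∀ u, 0 ≤ M u)
    (hMB : ∀ y' : Fin (3 + 1) → ℤ, ∑ b ∈ box (3 + 1) n, M ((n : ℤ) • y' + toSite b) ≤ T) :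
    (Summable fun u : Fin (3 + 1) → ℤ => |colH K n μ y κ u| * (M u * Real.exp (2 * σ * l1 (u - (n : ℤ) • y)))) ∧
      ∑' u : Fin (3 + 1) → ℤ, |colH K n μ y κ u| * (M u * Real.exp (2 * σ * l1 (u - (n : ℤ) • y)))
        ≤ CH * Real.exp (2 * ρ * (n : ℝ)) * Zl 4 (ρ * (n : ℝ) / 2) * T := by
  set ρ₂ : ℝ := ρ / 2 with hρ₂
  have hρ₂0 : 0 < ρ₂ := by positivity
  set c : Fin (3 + 1) → ℤ := (n : ℤ) • y with hc
  -- the weight `w u := colH … u · e^{2σ|u − c|₁}` has the envelope `C_H·e^{−(ρ∕2)|u − c|₁}`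
  have hw : ∀ u : Fin (3 + 1) → ℤ, |colH K n μ y κ u * Real.exp (2 * σ * l1 (u - c))| ≤ CH * Real.exp (-ρ₂ * l1 (u - (n : ℤ) • y)) := by
    intro u
    rw [abs_mul, abs_of_pos (Real.exp_pos _), ← hc]
    have h1 := hcol u
    have hl := l1_nonneg (u - c)
    calc |colH K n μ y κ u| * Real.exp (2 * σ * l1 (u - c))
        ≤ (CH * Real.exp (-ρ * l1 (u - c))) * Real.exp (2 * σ * l1 (u - c)) :=
          mul_le_mul_of_nonneg_right h1 (Real.exp_pos _).le
      _ = CH * Real.exp (-ρ * l1 (u - c) + 2 * σ * l1 (u - c)) := by rw [Real.exp_add]; ring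
      _ ≤ CH * Real.exp (-ρ₂ * l1 (u - c)) := by
          refine mul_le_mul_of_nonneg_left (Real.exp_le_exp.2 ?_) hCH
          rw [hρ₂]
          nlinarith [hl, hσ, hρ]
  obtain ⟨hs, hb⟩ := tsum_abs_mul_le_of_blockTotal (D := 3 + 1) (n := n)
    (w := fun u => colH K n μ y κ u * Real.exp (2 * σ * l1 (u - c))) (m := M) y hρ₂0 hCH hw hM0 hMB
  have e : (fun u : Fin (3 + 1) → ℤ => |colH K n μ y κ u| * (M u * Real.exp (2 * σ * l1 (u - c))))
      = fun u => |colH K n μ y κ u * Real.exp (2 * σ * l1 (u - c))| * M u := by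
    funext u
    rw [abs_mul, abs_of_pos (Real.exp_pos _)]; ring
  rw [e]
  refine ⟨hs, hb.trans (le_of_eq ?_)⟩
  have e1 : ρ₂ * (((3 + 1 : ℕ) : ℕ) : ℝ) * (n : ℝ) = 2 * ρ * (n : ℝ) := by rw [hρ₂]; push_cast; ring
  have e2 : ρ₂ * (n : ℝ) = ρ * (n : ℝ) / 2 := by rw [hρ₂]; ring
  rw [e1, e2]

/-- [folklore] **SUPERPOSITION FORM** (ANY packed kernel `K` with a displayed column envelope, ANY fibre `F`): for `0 ≤ σ ≤ ρ∕4` and a family `T κ u : MKer 4 F` whose members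
have summable `u`-centred weighted masses `M κ u := Σ'_{(p,q)} Σ_{ab} |T κ u p q a b|·e^{σ(|p − u|₁ + |q − u|₁)}` with BLOCK TOTALS `Σ_{b ∈ box 4 n} M κ (n•y′ + b) ≤ m̄T` (every
direction `κ`, every coarse block `y′`), the superposition `Σ_κ wsum (colH K n μ y κ) (T κ)` has centred weighted mass at `n•y`, rate `σ`, summable and
`≤ 4·(C_H·e^{2ρn}·Zl 4 (ρn∕2))·m̄T` — per slot the recentred letter (`stencil_mass_recentre`), per direction the previous lemma, four directions (`mass_sum_wsum_le`). -/
theorem mass_sum_wsum_colH_le_of_blockTotal {F : Type*} [Fintype F] {T : Fin (3 + 1) → (Fin (3 + 1) → ℤ) → MKer 4 F}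
    {CH ρ σ mT : ℝ} (hρ : 0 < ρ) (hCH : 0 ≤ CH) (hσ0 : 0 ≤ σ) (hσ : σ ≤ ρ / 4)
    (μ : Fin (3 + 1)) (y : Fin (3 + 1) → ℤ)
    (hcol : ∀ κ u, |colH K n μ y κ u| ≤ CH * Real.exp (-ρ * l1 (u - (n : ℤ) • y)))
    (hTs : ∀ κ u, Summable fun p : Site 4 × Site 4 => ∑ a, ∑ b, |T κ u p.1 p.2 a b| * Real.exp (σ * (l1 (p.1 - u) + l1 (p.2 - u))))
    (hTB : ∀ (κ : Fin (3 + 1)) (y' : Fin (3 + 1) → ℤ), ∑ b ∈ box (3 + 1) n,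
      (∑' p : Site 4 × Site 4, ∑ a, ∑ b', |T κ ((n : ℤ) • y' + toSite b) p.1 p.2 a b'|
        * Real.exp (σ * (l1 (p.1 - ((n : ℤ) • y' + toSite b)) + l1 (p.2 - ((n : ℤ) • y' + toSite b))))) ≤ mT) :
    (Summable fun p : Site 4 × Site 4 => ∑ a, ∑ b,
        |(∑ κ : Fin (3 + 1), wsum (colH K n μ y κ) (T κ)) p.1 p.2 a b| * Real.exp (σ * (l1 (p.1 - (n : ℤ) • y) + l1 (p.2 - (n : ℤ) • y)))) ∧
      ∑' p : Site 4 × Site 4, ∑ a, ∑ b,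
          |(∑ κ : Fin (3 + 1), wsum (colH K n μ y κ) (T κ)) p.1 p.2 a b| * Real.exp (σ * (l1 (p.1 - (n : ℤ) • y) + l1 (p.2 - (n : ℤ) • y)))
        ≤ 4 * (CH * Real.exp (2 * ρ * (n : ℝ)) * Zl 4 (ρ * (n : ℝ) / 2)) * mT := by
  set Z : ℝ := CH * Real.exp (2 * ρ * (n : ℝ)) * Zl 4 (ρ * (n : ℝ) / 2) with hZ
  set c : Site 4 := (n : ℤ) • y with hc
  set W : Site 4 × Site 4 → ℝ := fun p => Real.exp (σ * (l1 (p.1 - c) + l1 (p.2 - c))) with hW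
  have hWpos : ∀ p, 0 < W p := fun p => Real.exp_pos _
  -- the slot function: the family's own (summable) weighted masses
  set M : Fin (3 + 1) → (Fin (3 + 1) → ℤ) → ℝ := fun κ u =>
    ∑' p : Site 4 × Site 4, ∑ a, ∑ b, |T κ u p.1 p.2 a b| * Real.exp (σ * (l1 (p.1 - u) + l1 (p.2 - u))) with hM
  have hM0 : ∀ κ u, 0 ≤ M κ u := fun κ u =>
    tsum_nonneg fun p => Finset.sum_nonneg fun a _ => Finset.sum_nonneg fun b _ => by positivity
  -- per stencil: recentred letter `M κ u·e^{2σ|u − c|₁}`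
  have hrec : ∀ κ u, (Summable fun p : Site 4 × Site 4 => ∑ a, ∑ b, |T κ u p.1 p.2 a b| * W p) ∧
      ∑' p : Site 4 × Site 4, ∑ a, ∑ b, |T κ u p.1 p.2 a b| * W p ≤ M κ u * Real.exp (2 * σ * l1 (u - c)) :=
    fun κ u => stencil_mass_recentre hσ0 u c (hTs κ u) le_rfl
  -- per direction: the weight letter against the block totals
  have hw : ∀ κ : Fin (3 + 1),
      (Summable fun u : Site 4 => |colH K n μ y κ u| * (M κ u * Real.exp (2 * σ * l1 (u - c)))) ∧
      ∑' u : Site 4, |colH K n μ y κ u| * (M κ u * Real.exp (2 * σ * l1 (u - c))) ≤ Z * mT := by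
    intro κ
    obtain ⟨hs, hb⟩ := tsum_abs_colH_mul_le_of_blockTotal K n hρ hCH hσ μ y κ (hcol κ) (M := M κ) (T := mT) (hM0 κ) (hTB κ)
    rw [← hc] at hs hb
    exact ⟨hs, hb.trans (le_of_eq (by rw [hZ]))⟩
  have hsum := mass_sum_wsum_le (Finset.univ : Finset (Fin (3 + 1)))
    (w := fun κ u => colH K n μ y κ u) (K := fun κ u => T κ u) (M := fun _ => Z * mT) hWpos (fun κ u => (hrec κ u).1)
    (fun κ u => (hrec κ u).2) (fun κ => (hw κ).1) (fun κ => (hw κ).2)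
  refine ⟨hsum.1, hsum.2.trans (le_of_eq ?_)⟩
  rw [Finset.sum_const, Finset.card_univ, Fintype.card_fin, nsmul_eq_mul]
  push_cast
  ring

/-- [folklore] **THE (M-b) PACKED-VERTEX ROW AT ANY PACKED KERNEL WITH A DISPLAYED COLUMN ENVELOPE**: for `0 ≤ σ ≤ ρ∕4` and a first-jet pack `S` (fibre `Fib 3`) whose blocks
have summable per-slot `u`-centred weighted masses and BLOCK-TOTAL letters `Σ_{b ∈ box 4 n} Σ'_{(p,q)} Σ_{g f} |blk (S κ (n•y′ + b)) j k p q g f|·e^{σ(|p − (n•y′+b)|₁ + |q − (n•y′+b)|₁)}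
≤ T j k` (every direction `κ`, every coarse block `y′`), every block of `vertexOfK K n S μ y` has centred weighted mass at `n•y`, rate `σ`, summable and
`≤ 4·(C_H·e^{2ρn}·Zl 4 (ρn∕2))·T j k` — the single-vertex twin of FILE 4 §3's `mass_blk_vertex2OfK_le_of_blockPairTotal` (`blk_vertexOfK` BY NAME). -/
theorem mass_blk_vertexOfK_le_of_blockTotal {S : Fin (3 + 1) → (Fin (3 + 1) → ℤ) → MKer 4 (Fib 3)} {CH ρ σ : ℝ} {T : Bool → Bool → ℝ}
    (hρ : 0 < ρ) (hCH : 0 ≤ CH) (hσ0 : 0 ≤ σ) (hσ : σ ≤ ρ / 4)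
    (μ : Fin (3 + 1)) (y : Fin (3 + 1) → ℤ)
    (hcol : ∀ κ u, |colH K n μ y κ u| ≤ CH * Real.exp (-ρ * l1 (u - (n : ℤ) • y)))
    (hSs : ∀ κ u j k, Summable fun p : Site 4 × Site 4 =>
      ∑ g, ∑ f, |blk (S κ u) j k p.1 p.2 g f| * Real.exp (σ * (l1 (p.1 - u) + l1 (p.2 - u))))
    (hSB : ∀ (κ : Fin (3 + 1)) (y' : Fin (3 + 1) → ℤ) (j k : Bool), ∑ b ∈ box (3 + 1) n,
      (∑' p : Site 4 × Site 4, ∑ g, ∑ f, |blk (S κ ((n : ℤ) • y' + toSite b)) j k p.1 p.2 g f|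
        * Real.exp (σ * (l1 (p.1 - ((n : ℤ) • y' + toSite b)) + l1 (p.2 - ((n : ℤ) • y' + toSite b))))) ≤ T j k)
    (j k : Bool) :
    (Summable fun p : Site 4 × Site 4 => ∑ g, ∑ f,
        |blk (vertexOfK K n S μ y) j k p.1 p.2 g f| * Real.exp (σ * (l1 (p.1 - (n : ℤ) • y) + l1 (p.2 - (n : ℤ) • y)))) ∧
      ∑' p : Site 4 × Site 4, ∑ g, ∑ f,
          |blk (vertexOfK K n S μ y) j k p.1 p.2 g f| * Real.exp (σ * (l1 (p.1 - (n : ℤ) • y) + l1 (p.2 - (n : ℤ) • y)))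
        ≤ 4 * (CH * Real.exp (2 * ρ * (n : ℝ)) * Zl 4 (ρ * (n : ℝ) / 2)) * T j k := by
  rw [blk_vertexOfK]
  exact mass_sum_wsum_colH_le_of_blockTotal K n (T := fun κ u => blk (S κ u) j k) hρ hCH hσ0 hσ μ y hcol (fun κ u => hSs κ u j k)
    (fun κ y' => hSB κ y' j k)

end Generic

/-! ## §2 The STRAIGHT one-shot column `colH (KInvStep 3 n 0) n` (any `n`, `[NeZero n]`): its `n⁻⁵` envelope in the road's `ℓ¹` form and its weighted `ℓ¹` law `≤ n⁻¹·(…)` -/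

section Straight

/-- [folklore] **«K0-COL-ENV» FOR THE ROAD** (`d = 3`, ANY block side `n ≥ 1`, ANY coarse bond `(μ, y)`, ANY fine direction `κ`):
`∀ u, |colH (KInvStep 3 n 0) n μ y κ u| ≤ (n⁵)⁻¹·(C₄·e^{κ′})·e^{−(κ′∕(4n))·|u − n•y|₁}`, `C₄ = MG163 4·periodConst (kappa163 4) 3`, `κ′ = kappa163 4 ∕ 4` — the UNDRESSED
one-shot column IS the minimiser kernel `wH^{(n)}` (`PackedColumnEnvelope.abs_colH_KInvStep_zero_le`, over d1-formalise-leaf-05's unconditional `abs_wH_le`), its block-scale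
envelope moved to the fine `ℓ¹` currency by `EnvelopeBlockSum.env_le_exp_l1`; UNCONDITIONAL, ONE power below the bm-dressed column's «G0-COL-ENV» `n⁻⁴`.  (Same VALUE as
`GhostWardWord.abs_colH_K₀_road_le_l1` ∕ `BlockGaugeEnvelope.abs_colH_K₀_env`; re-derived here to keep this file's import closure at FILE 4.) -/
theorem abs_colH_K₀_road_le (n : ℕ) [NeZero n] (μ : Fin (3 + 1)) (y : Fin (3 + 1) → ℤ) (κ : Fin (3 + 1)) :
    ∀ u : Fin (3 + 1) → ℤ, |colH (KInvStep (d := 3) n 0) n μ y κ u|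
      ≤ (((n : ℝ) ^ 5)⁻¹ * ((MG163 4 * periodConst (kappa163 4) 3) * Real.exp (kappa163 4 / 4)))
        * Real.exp (-(kappa163 4 / 4 / (4 * (n : ℝ))) * l1 (u - (n : ℤ) • y)) := by
  intro u
  have hN : 1 ≤ n := Nat.one_le_iff_ne_zero.mpr (NeZero.ne n)
  have h := abs_colH_KInvStep_zero_le (d := 3) (N := n) hN μ y κ u
  have hc : 0 ≤ kappa163 (3 + 1) / ((3 : ℝ) + 1) := div_nonneg (kappa163_pos _).le (by positivity)
  have hM : 0 ≤ ((n : ℝ) ^ (3 + 2))⁻¹ * (MG163 (3 + 1) * periodConst (kappa163 (3 + 1)) 3) :=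
    (mul_nonneg_iff_of_pos_right (Real.exp_pos _)).1 ((abs_nonneg _).trans h)
  have he := env_le_exp_l1 (d := 3) hN hc y u
  refine (h.trans (mul_le_mul_of_nonneg_left he hM)).trans_eq ?_
  have e1 : (3 : ℕ) + 1 = 4 := rfl
  have e2 : (3 : ℕ) + 2 = 5 := rfl
  have e3 : ((3 : ℕ) : ℝ) + 1 = 4 := by norm_num
  have e4 : (3 : ℝ) + 1 = 4 := by norm_num
  simp only [e1, e2, e3, e4]
  ring

/-- [folklore] The straight column's weight constant is nonnegative (for the `hCH` slots of §1 ∕ FILE 4 §3). -/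
theorem colH_K₀_road_weight_nonneg (n : ℕ) [NeZero n] :
    0 ≤ ((n : ℝ) ^ 5)⁻¹ * ((MG163 4 * periodConst (kappa163 4) 3) * Real.exp (kappa163 4 / 4)) := by
  have h := abs_colH_K₀_road_le n 0 0 0 0
  exact (mul_nonneg_iff_of_pos_right (Real.exp_pos _)).1 ((abs_nonneg _).trans h)

/-- [folklore] **«K0-COL-L1»: THE STRAIGHT COLUMN's WEIGHTED `ℓ¹` LAW IS ONE POWER BELOW ITS `n⁴` SLOTS**: for `σ ≤ κ′∕(16n)` (any sign), every coarse bond `(μ, y)` and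
fine direction `κ`, `Σ'_u |colH (KInvStep 3 n 0) n μ y κ u|·e^{2σ|u − n•y|₁} ≤ n⁻¹·(C₄·e^{κ′}·e^{κ′∕2}·Zl 4 (κ′∕8))`, summable — §1 at «K0-COL-ENV» with the slot function
`M ≡ 1` (block totals `= n⁴ = (box 4 n).card`): `(n⁵)⁻¹·n⁴ = n⁻¹`.  Multiplied by the literal's `cE = n⁴` this is the unit page's `Σ_u |h(u)| ≍ n³` as a BOUND. -/
theorem tsum_abs_colH_K₀_mul_exp_le (n : ℕ) [NeZero n] {σ : ℝ} (hσ : σ ≤ kappa163 4 / 4 / (16 * (n : ℝ)))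
    (μ : Fin (3 + 1)) (y : Fin (3 + 1) → ℤ) (κ : Fin (3 + 1)) :
    (Summable fun u : Fin (3 + 1) → ℤ =>
        |colH (KInvStep (d := 3) n 0) n μ y κ u| * Real.exp (2 * σ * l1 (u - (n : ℤ) • y))) ∧
      ∑' u : Fin (3 + 1) → ℤ, |colH (KInvStep (d := 3) n 0) n μ y κ u| * Real.exp (2 * σ * l1 (u - (n : ℤ) • y))
        ≤ (n : ℝ)⁻¹ * (((MG163 4 * periodConst (kappa163 4) 3) * Real.exp (kappa163 4 / 4))
            * Real.exp (kappa163 4 / 4 / 2) * Zl 4 (kappa163 4 / 4 / 8)) := by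
  have hn0 : (0 : ℝ) < (n : ℝ) := by exact_mod_cast Nat.pos_of_ne_zero (NeZero.ne n)
  set C : ℝ := (MG163 4 * periodConst (kappa163 4) 3) * Real.exp (kappa163 4 / 4) with hC
  set aa : ℝ := kappa163 4 / 4 / (4 * (n : ℝ)) with haa
  have hκ : 0 < kappa163 4 := kappa163_pos 4
  have haa0 : 0 < aa := by positivity
  have hσ' : σ ≤ aa / 4 := by
    refine hσ.trans (le_of_eq ?_)
    rw [haa]; field_simp; ring
  -- block totals of the constant slot function `1` are `(box 4 n).card = n⁴`
  have hcard : ((box (3 + 1) n).card : ℝ) = (n : ℝ) ^ 4 := by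
    have h : (box (3 + 1) n).card = n ^ (3 + 1) := by simp [AffineAveraging.box, Fintype.card_piFinset]
    rw [h]; push_cast; ring
  have hMB : ∀ y' : Fin (3 + 1) → ℤ, ∑ b ∈ box (3 + 1) n, (fun _ : Fin (3 + 1) → ℤ => (1 : ℝ)) ((n : ℤ) • y' + toSite b)
      ≤ (n : ℝ) ^ 4 := fun y' => by
    rw [Finset.sum_const, nsmul_eq_mul, mul_one, hcard]
  obtain ⟨hs, hb⟩ := tsum_abs_colH_mul_le_of_blockTotal (KInvStep (d := 3) n 0) n haa0 (colH_K₀_road_weight_nonneg n) hσ' μ y κ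
    (abs_colH_K₀_road_le n μ y κ) (M := fun _ => (1 : ℝ)) (T := (n : ℝ) ^ 4) (fun _ => zero_le_one) hMB
  simp only [one_mul] at hs hb
  refine ⟨hs, hb.trans (le_of_eq ?_)⟩
  -- the constants: `2·aa·n = κ′∕2`, `aa·n∕2 = κ′∕8`, `(n⁵)⁻¹·n⁴ = n⁻¹`
  have e1 : 2 * aa * (n : ℝ) = kappa163 4 / 4 / 2 := by rw [haa]; field_simp; ring
  have e2 : aa * (n : ℝ) / 2 = kappa163 4 / 4 / 8 := by rw [haa]; field_simp; ring
  rw [e1, e2]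
  have hn5 : ((n : ℝ)) ^ 5 ≠ 0 := by positivity
  have hn : ((n : ℝ)) ≠ 0 := hn0.ne'
  field_simp
  ring

end Straight

end Summit.QuantumFields.BalabanUV.Beta.D1BFx.PackedStraightColumn

end
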